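import Summits.AtomisticToContinuum.Crystallization.Theorems.ChartedZeroExcessLayeredLatticeLiouvilleUV
import Summits.AtomisticToContinuum.Crystallization.Theorems.ExcessDecayLiouvilleHcpLiouvilleAnchorNewton

/-!
# Zero-excess layered lattice Liouville — part UW (lens-2 g57, node «TailCert» 2/2): (T) `TailDominationCert` PROVED.

`tailDominationCert_holds : TailDominationCert` (part R, VERBATIM) with `ϱ₀(c, ε) := max 1 (20520 / (ε·c⁷))`.
MECHANISM (configuration-free; [giaquinta1984 Ch. III §2 difference quotients; folklore lattice sums]).  Both conjuncts of (T) follow from ONE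
uniform bound on finite partial sums of the (non-negative) tail family, `Σ_{x ∈ T} tailFam ≤ (20520/(ϱc⁷))·nnFormZ φ`
(`summable_of_sum_le`, `Real.tsum_le_of_sum_le`).  The bound: (1) POINTWISE (`tailFam_le`): a far bond `x = (X, Y)`, `|p_Y − p_X| > ϱ ≥ 1`, has
`Y ≠ X`, kernel `forceConst (p_Y − p_X)` (US `layeredKernel_sub_fst_eq`) of norm `≤ 38|p_Y − p_X|⁻⁸ ≤ 38/(ϱc⁷)·N(Y−X)⁻⁷` (UV.1 + co-Lipschitz
`|p_Y − p_X| ≥ c·dist X Y ≥ c·N(Y−X)`, UV.2); (2) REGROUP by the index displacement `v = Y − X` (`Finset.sum_fiberwise_of_maps_to`; on a fibre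
`X ↦ x` is injective): `Σ_{x ∈ T} N⁻⁷‖φY − φX‖² ≤ Σ_v N(v)⁻⁷ · dispSq φ v`; (3) DISCRETE POINCARÉ (UV.3 + the axis decomposition UW.1):
`dispSq φ v ≤ 10·N(v)²·nnFormZ φ`; (4) SHELL SUM (UV.2): `Σ_v N(v)⁻⁵ ≤ 54`.  Total constant `38·10·54 = 20520`.
LEAVES of [SBᵇ] after this part: (LD) `LinearExcessDecayZ`, (RC) `EquilChartStrainP`, (I4ˢ) `TailFluxBSP`, hU, hN and the two typed glues (UR);
struck so far: (I1) (UP), (PT) (US), (HC) (UU), (T) (UW).  No statement of the column is re-typed here; `IsTameIndexing` is not used.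
-/

noncomputable section

open scoped BigOperators InnerProductSpace RealInnerProductSpace
open MeasureTheory Set Metric Filter Topology
open Summit.AtomisticToContinuum.Crystallization.Theorems.ChartedPlanarOrderRigidityDoor (E3 IsNash atomsIn)
open Summit.AtomisticToContinuum.Crystallization.Theorems.ChartedPlanarOrderDensityDichotomy (μS IsSep nK nK_nonneg)
open Summit.AtomisticToContinuum.Crystallization.Theorems.ChartedPlanarOrderDoorLayered (Layered layeredHom_eq_layered)

namespace Summit.AtomisticToContinuum.Crystallization.Theorems.ChartedZeroExcessLayeredLatticeLiouville

section TailCert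

variable {c : ℝ} {a b : E3} {w : ℤ → E3} {φ : Cell 2 → ℤ → E3} {S : Finset (Cell 2 × ℤ)}

/-! ### UW.1  Axis decomposition: `dispSq φ v ≤ 10 · N(v)² · nnFormZ φ` -/

/-- the three index axes. [this file, g57] -/
def idxAxis₁ : Cell 2 × ℤ := (Pi.single 0 1, 0)

/-- see `idxAxis₁`. -/
def idxAxis₂ : Cell 2 × ℤ := (Pi.single 1 1, 0)

/-- see `idxAxis₁`. -/
def idxAxis₃ : Cell 2 × ℤ := (0, 1)

/-- Auxiliary step (`idx decomp`). [formal bookkeeping] -/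
theorem idx_decomp (v : Cell 2 × ℤ) : v = v.1 0 • idxAxis₁ + v.1 1 • idxAxis₂ + v.2 • idxAxis₃ := by
  refine Prod.ext (funext fun j => ?_) ?_
  · fin_cases j <;> simp [idxAxis₁, idxAxis₂, idxAxis₃]
  · simp [idxAxis₁, idxAxis₂, idxAxis₃]

/-- Auxiliary step (`dist add idxAxis₁ le`). [formal bookkeeping] -/
theorem dist_add_idxAxis₁_le (U : Cell 2 × ℤ) : dist U (U + idxAxis₁) ≤ 1 := by
  rw [Prod.dist_eq]
  refine max_le ((dist_pi_le_iff zero_le_one).mpr fun j => ?_) ?_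
  · fin_cases j <;> simp [idxAxis₁]
  · simp [idxAxis₁]

/-- Auxiliary step (`dist add idxAxis₂ le`). [formal bookkeeping] -/
theorem dist_add_idxAxis₂_le (U : Cell 2 × ℤ) : dist U (U + idxAxis₂) ≤ 1 := by
  rw [Prod.dist_eq]
  refine max_le ((dist_pi_le_iff zero_le_one).mpr fun j => ?_) ?_
  · fin_cases j <;> simp [idxAxis₂]
  · simp [idxAxis₂]

/-- Auxiliary step (`dist add idxAxis₃ le`). [formal bookkeeping] -/
theorem dist_add_idxAxis₃_le (U : Cell 2 × ℤ) : dist U (U + idxAxis₃) ≤ 1 := by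
  rw [Prod.dist_eq]
  refine max_le ((dist_pi_le_iff zero_le_one).mpr fun j => ?_) ?_
  · fin_cases j <;> simp [idxAxis₃]
  · simp [idxAxis₃]

/-- Auxiliary step (`dispSq add le two`). [formal bookkeeping] -/
theorem dispSq_add_le_two (hS : ∀ U : Cell 2 × ℤ, U ∉ S → φ U.1 U.2 = 0) (t t' : Cell 2 × ℤ) :
    dispSq φ (t + t') ≤ 2 * dispSq φ t + 2 * dispSq φ t' := by
  have h := dispSq_add_le hS t t' zero_le_one
  linarith

/-- Auxiliary step (`sq cast le of natAbs le`). [formal bookkeeping] -/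
theorem sq_cast_le_of_natAbs_le {z : ℤ} {n : ℕ} (h : z.natAbs ≤ n) : (z : ℝ) ^ 2 ≤ (n : ℝ) ^ 2 := by
  have h' : |(z : ℝ)| ≤ n := by rw [← Int.cast_abs, ← Nat.cast_natAbs]; exact_mod_cast h
  rw [← sq_abs]
  exact pow_le_pow_left₀ (abs_nonneg _) h' 2

/-- ★ `dispSq φ v ≤ 10 · N(v)² · nnFormZ φ`. [giaquinta1984 Ch. III §2; this file, g57] -/
theorem dispSq_le_idxNorm_sq (hS : ∀ U : Cell 2 × ℤ, U ∉ S → φ U.1 U.2 = 0) (v : Cell 2 × ℤ) :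
    dispSq φ v ≤ 10 * (idxNorm v : ℝ) ^ 2 * nnFormZ φ := by
  have hN := nnFormZ_nonneg φ
  have h1 : dispSq φ (v.1 0 • idxAxis₁) ≤ (idxNorm v : ℝ) ^ 2 * nnFormZ φ :=
    (dispSq_zsmul_le hS _ _).trans (mul_le_mul (sq_cast_le_of_natAbs_le (natAbs_fst_le_idxNorm v 0))
      (dispSq_le_nnFormZ hS dist_add_idxAxis₁_le) (dispSq_nonneg φ _) (by positivity))
  have h2 : dispSq φ (v.1 1 • idxAxis₂) ≤ (idxNorm v : ℝ) ^ 2 * nnFormZ φ :=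
    (dispSq_zsmul_le hS _ _).trans (mul_le_mul (sq_cast_le_of_natAbs_le (natAbs_fst_le_idxNorm v 1))
      (dispSq_le_nnFormZ hS dist_add_idxAxis₂_le) (dispSq_nonneg φ _) (by positivity))
  have h3 : dispSq φ (v.2 • idxAxis₃) ≤ (idxNorm v : ℝ) ^ 2 * nnFormZ φ :=
    (dispSq_zsmul_le hS _ _).trans (mul_le_mul (sq_cast_le_of_natAbs_le (natAbs_snd_le_idxNorm v))
      (dispSq_le_nnFormZ hS dist_add_idxAxis₃_le) (dispSq_nonneg φ _) (by positivity))
  have h12 := dispSq_add_le_two hS (v.1 0 • idxAxis₁) (v.1 1 • idxAxis₂)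
  have h123 := dispSq_add_le_two hS (v.1 0 • idxAxis₁ + v.1 1 • idxAxis₂) (v.2 • idxAxis₃)
  rw [← idx_decomp v] at h123
  linarith

/-! ### UW.2  The pointwise far bound -/

/-- Auxiliary step (`tailFam nonneg`). [formal bookkeeping] -/
theorem tailFam_nonneg (ϱ : ℝ) (a b : E3) (w : ℤ → E3) (φ : Cell 2 → ℤ → E3) (x : (Cell 2 × ℤ) × (Cell 2 × ℤ)) :
    0 ≤ tailFam ϱ a b w φ x := by
  unfold tailFam; split_ifs <;> positivity

/-- the regrouping weight `N(Y − X)⁻⁷ · ‖φ Y − φ X‖²` of a bond `x = (X, Y)`. [this file, g57] -/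
def tailWeightFam (φ : Cell 2 → ℤ → E3) (x : (Cell 2 × ℤ) × (Cell 2 × ℤ)) : ℝ :=
  (((idxNorm (x.2 - x.1) : ℝ)) ^ 7)⁻¹ * dispSqFam φ (x.2 - x.1) x.1

/-- Auxiliary step (`tailWeightFam nonneg`). [formal bookkeeping] -/
theorem tailWeightFam_nonneg (φ : Cell 2 → ℤ → E3) (x : (Cell 2 × ℤ) × (Cell 2 × ℤ)) : 0 ≤ tailWeightFam φ x := by
  unfold tailWeightFam; exact mul_nonneg (by positivity) (dispSqFam_nonneg φ _ _)

/-- ★ POINTWISE FAR BOUND: in a `c`-co-Lipschitz layered crystal and for `ϱ ≥ 1`,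
`tailFam x ≤ 38/(ϱc⁷) · N(Y − X)⁻⁷ · ‖φ Y − φ X‖²`. [this file, g57] -/
theorem tailFam_le (hc : 0 < c) (hL : IsLayeredCrystal c a b w) {ϱ : ℝ} (hϱ : 1 ≤ ϱ) (φ : Cell 2 → ℤ → E3)
    (x : (Cell 2 × ℤ) × (Cell 2 × ℤ)) :
    tailFam ϱ a b w φ x ≤ 38 / (ϱ * c ^ 7) * tailWeightFam φ x := by
  have hϱ0 : 0 < ϱ := by linarith
  unfold tailWeightFam
  rw [dispSqFam_sub_fst]
  unfold tailFam
  split_ifs with hfar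
  · have hne : x.2 ≠ x.1 := by
      intro h
      rw [h, sub_self, norm_zero] at hfar
      linarith
    rw [layeredKernel_sub_fst_eq a b w x.1 x.2, if_neg hne]
    have hK : ‖forceConst (lsite a b w x.2.1 x.2.2 - lsite a b w x.1.1 x.1.2)‖ ≤
        38 * (‖lsite a b w x.2.1 x.2.2 - lsite a b w x.1.1 x.1.2‖⁻¹) ^ 8 :=
      Summit.AtomisticToContinuum.Crystallization.Theorems.ExcessDecayLiouville.norm_forceConst_le (by linarith)
    have hNpos : 0 < idxNorm (x.2 - x.1) := Nat.lt_of_lt_of_le Nat.zero_lt_one (idxNorm_pos (sub_ne_zero.mpr hne))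
    have hcN : c * (idxNorm (x.2 - x.1) : ℝ) ≤ ‖lsite a b w x.2.1 x.2.2 - lsite a b w x.1.1 x.1.2‖ :=
      calc c * (idxNorm (x.2 - x.1) : ℝ) ≤ c * dist x.1 x.2 := mul_le_mul_of_nonneg_left (idxNorm_le_dist x.1 x.2) hc.le
        _ ≤ ‖lsite a b w x.1.1 x.1.2 - lsite a b w x.2.1 x.2.2‖ := hL x.1 x.2
        _ = ‖lsite a b w x.2.1 x.2.2 - lsite a b w x.1.1 x.1.2‖ := norm_sub_rev _ _
    have hpos : 0 < ϱ * c ^ 7 * (idxNorm (x.2 - x.1) : ℝ) ^ 7 := by positivity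
    have hinv : (‖lsite a b w x.2.1 x.2.2 - lsite a b w x.1.1 x.1.2‖⁻¹) ^ 8 ≤
        (ϱ * c ^ 7 * (idxNorm (x.2 - x.1) : ℝ) ^ 7)⁻¹ := by
      rw [inv_pow]
      refine inv_anti₀ hpos ?_
      calc ϱ * c ^ 7 * (idxNorm (x.2 - x.1) : ℝ) ^ 7 = ϱ * (c * (idxNorm (x.2 - x.1) : ℝ)) ^ 7 := by ring
        _ ≤ ‖lsite a b w x.2.1 x.2.2 - lsite a b w x.1.1 x.1.2‖ * ‖lsite a b w x.2.1 x.2.2 - lsite a b w x.1.1 x.1.2‖ ^ 7 :=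
            mul_le_mul hfar.le (pow_le_pow_left₀ (by positivity) hcN 7) (by positivity) (norm_nonneg _)
        _ = ‖lsite a b w x.2.1 x.2.2 - lsite a b w x.1.1 x.1.2‖ ^ 8 := by ring
    calc ‖forceConst (lsite a b w x.2.1 x.2.2 - lsite a b w x.1.1 x.1.2)‖ * ‖φ x.2.1 x.2.2 - φ x.1.1 x.1.2‖ ^ 2
        ≤ 38 * (ϱ * c ^ 7 * (idxNorm (x.2 - x.1) : ℝ) ^ 7)⁻¹ * ‖φ x.2.1 x.2.2 - φ x.1.1 x.1.2‖ ^ 2 :=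
          mul_le_mul_of_nonneg_right (hK.trans (mul_le_mul_of_nonneg_left hinv (by norm_num))) (sq_nonneg _)
      _ = 38 / (ϱ * c ^ 7) * ((((idxNorm (x.2 - x.1) : ℝ)) ^ 7)⁻¹ * ‖φ x.2.1 x.2.2 - φ x.1.1 x.1.2‖ ^ 2) := by
          rw [mul_inv, div_eq_mul_inv]; ring
  · exact mul_nonneg (by positivity) (mul_nonneg (by positivity) (sq_nonneg _))

/-! ### UW.3  Regrouping by the index displacement -/

/-- ★ REGROUPED BOUND: `Σ_{x ∈ T} N(Y−X)⁻⁷‖φY − φX‖² ≤ 540 · nnFormZ φ` for every finite set of bonds `T`. [this file, g57] -/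
theorem sum_tailWeightFam_le (hS : ∀ U : Cell 2 × ℤ, U ∉ S → φ U.1 U.2 = 0) (T : Finset ((Cell 2 × ℤ) × (Cell 2 × ℤ))) :
    ∑ x ∈ T, tailWeightFam φ x ≤ 540 * nnFormZ φ := by
  classical
  have hN := nnFormZ_nonneg φ
  have hfib : ∑ x ∈ T, tailWeightFam φ x =
      ∑ v ∈ T.image (fun x => x.2 - x.1), ∑ x ∈ T with x.2 - x.1 = v, tailWeightFam φ x :=
    (Finset.sum_fiberwise_of_maps_to (fun x hx => Finset.mem_image_of_mem (fun x => x.2 - x.1) hx) _).symm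
  have hinner : ∀ v : Cell 2 × ℤ, ∑ x ∈ T with x.2 - x.1 = v, tailWeightFam φ x ≤ (((idxNorm v : ℝ)) ^ 7)⁻¹ * dispSq φ v := by
    intro v
    have h1 : ∑ x ∈ T with x.2 - x.1 = v, tailWeightFam φ x =
        (((idxNorm v : ℝ)) ^ 7)⁻¹ * ∑ x ∈ T with x.2 - x.1 = v, dispSqFam φ v x.1 := by
      rw [Finset.mul_sum]
      refine Finset.sum_congr rfl fun x hx => ?_
      have hxv : x.2 - x.1 = v := (Finset.mem_filter.mp hx).2
      unfold tailWeightFam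
      rw [hxv]
    have hinj : Set.InjOn (fun x : (Cell 2 × ℤ) × (Cell 2 × ℤ) => x.1) ↑(T.filter fun x => x.2 - x.1 = v) := by
      intro x hx y hy hxy
      have hx' : x.2 - x.1 = v := (Finset.mem_filter.mp (Finset.mem_coe.mp hx)).2
      have hy' : y.2 - y.1 = v := (Finset.mem_filter.mp (Finset.mem_coe.mp hy)).2
      have ex : x.2 = x.1 + v := by rw [← hx', add_sub_cancel]
      have ey : y.2 = y.1 + v := by rw [← hy', add_sub_cancel]
      have hxy' : x.1 = y.1 := hxy
      exact Prod.ext hxy' (by rw [ex, ey, hxy'])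
    have h2 : ∑ x ∈ T with x.2 - x.1 = v, dispSqFam φ v x.1 =
        ∑ U ∈ (T.filter fun x => x.2 - x.1 = v).image (fun x => x.1), dispSqFam φ v U :=
      (Finset.sum_image hinj).symm
    have h3 : ∑ U ∈ (T.filter fun x => x.2 - x.1 = v).image (fun x => x.1), dispSqFam φ v U ≤ dispSq φ v :=
      sum_le_finsum_of_nonneg _ (fun U => dispSqFam_nonneg φ v U) (support_dispSqFam_finite hS v)
    rw [h1, h2]
    exact mul_le_mul_of_nonneg_left h3 (by positivity)
  calc ∑ x ∈ T, tailWeightFam φ x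
      = ∑ v ∈ T.image (fun x => x.2 - x.1), ∑ x ∈ T with x.2 - x.1 = v, tailWeightFam φ x := hfib
    _ ≤ ∑ v ∈ T.image (fun x => x.2 - x.1), (((idxNorm v : ℝ)) ^ 7)⁻¹ * dispSq φ v :=
        Finset.sum_le_sum fun v _ => hinner v
    _ ≤ ∑ v ∈ T.image (fun x => x.2 - x.1), (((idxNorm v : ℝ)) ^ 7)⁻¹ * (10 * (idxNorm v : ℝ) ^ 2 * nnFormZ φ) :=
        Finset.sum_le_sum fun v _ => mul_le_mul_of_nonneg_left (dispSq_le_idxNorm_sq hS v) (by positivity)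
    _ = 10 * nnFormZ φ * ∑ v ∈ T.image (fun x => x.2 - x.1), (((idxNorm v : ℝ)) ^ 7)⁻¹ * (idxNorm v : ℝ) ^ 2 := by
        rw [Finset.mul_sum]
        exact Finset.sum_congr rfl fun v _ => by ring
    _ ≤ 10 * nnFormZ φ * 54 := mul_le_mul_of_nonneg_left (sum_idxWeight_le _) (by positivity)
    _ = 540 * nnFormZ φ := by ring

/-! ### UW.4  (T) -/

/-- ★ the UNIFORM PARTIAL-SUM BOUND: `Σ_{x ∈ T} tailFam ≤ (20520/(ϱc⁷)) · nnFormZ φ`. [this file, g57] -/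
theorem sum_tailFam_le (hc : 0 < c) (hL : IsLayeredCrystal c a b w) {ϱ : ℝ} (hϱ : 1 ≤ ϱ)
    (hS : ∀ U : Cell 2 × ℤ, U ∉ S → φ U.1 U.2 = 0) (T : Finset ((Cell 2 × ℤ) × (Cell 2 × ℤ))) :
    ∑ x ∈ T, tailFam ϱ a b w φ x ≤ 20520 / (ϱ * c ^ 7) * nnFormZ φ := by
  have hϱ0 : 0 < ϱ := by linarith
  calc ∑ x ∈ T, tailFam ϱ a b w φ x ≤ ∑ x ∈ T, 38 / (ϱ * c ^ 7) * tailWeightFam φ x :=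
        Finset.sum_le_sum fun x _ => tailFam_le hc hL hϱ φ x
    _ = 38 / (ϱ * c ^ 7) * ∑ x ∈ T, tailWeightFam φ x := (Finset.mul_sum _ _ _).symm
    _ ≤ 38 / (ϱ * c ^ 7) * (540 * nnFormZ φ) := mul_le_mul_of_nonneg_left (sum_tailWeightFam_le hS T) (by positivity)
    _ = 20520 / (ϱ * c ^ 7) * nnFormZ φ := by ring

/-- ★★ **(T) PROVED** — the TAIL-DOMINATION CERTIFICATE of part R, with `ϱ₀(c, ε) := max 1 (20520/(ε·c⁷))`.
[giaquinta1984 Ch. III §2; folklore; this file, g57] -/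
theorem tailDominationCert_holds : TailDominationCert := by
  intro c hc ε hε
  refine ⟨max 1 (20520 / (ε * c ^ 7)), lt_max_of_lt_left one_pos, ?_⟩
  intro ϱ hϱ a b w hL φ hφ
  obtain ⟨S, hS'⟩ := hφ
  have hS : ∀ U : Cell 2 × ℤ, U ∉ S → φ U.1 U.2 = 0 := fun U hU => hS' U.1 U.2 hU
  have hϱ1 : 1 ≤ ϱ := (le_max_left _ _).trans hϱ
  have hϱ2 : 20520 / (ε * c ^ 7) ≤ ϱ := (le_max_right _ _).trans hϱ
  have hϱ0 : 0 < ϱ := by linarith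
  have hC : 20520 / (ϱ * c ^ 7) ≤ ε := by
    rw [div_le_iff₀ (by positivity)]
    have h := (div_le_iff₀ (by positivity)).mp hϱ2
    linarith
  have hbound : ∀ T : Finset ((Cell 2 × ℤ) × (Cell 2 × ℤ)), ∑ x ∈ T, tailFam ϱ a b w φ x ≤ ε * nnFormZ φ :=
    fun T => (sum_tailFam_le hc hL hϱ1 hS T).trans (mul_le_mul_of_nonneg_right hC (nnFormZ_nonneg φ))
  show Summable (tailFam ϱ a b w φ) ∧ ∑' x, tailFam ϱ a b w φ x ≤ ε * nnFormZ φ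
  exact ⟨summable_of_sum_le (fun x => tailFam_nonneg ϱ a b w φ x) hbound,
    Real.tsum_le_of_sum_le (fun x => tailFam_nonneg ϱ a b w φ x) hbound⟩

end TailCert

end Summit.AtomisticToContinuum.Crystallization.Theorems.ChartedZeroExcessLayeredLatticeLiouville
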